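import Literature.NumberTheory.EllipticCurves.CastellaGrossiSkinner2025.MazurMainConjecture
import Literature.NumberTheory.EllipticCurves.Rank1Residual.PrintShapeTorsion
import Literature.NumberTheory.EllipticCurves.HeegnerPoints
import Literature.NumberTheory.EllipticCurves.QuadraticTwist
import HarnessLib

/-!
# Burungale–Skinner–Tian–Wan (arXiv:2409.01350v2, PREPRINT), §11.3.1 Prop. 11.11 for an elliptic
# curve at an ORDINARY prime: "Kato's main conj. for `E` and for `E ⊗ χ_L` ⟹ the `p`-part of BSD in
# analytic rank one" — ONE explicitly labelled OPEN binder (claim-tagged; NEVER a fact), with the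
# two main-conj. hypotheses spelled in the tree's Néron-normalised cyclotomic currency

Written by the typer seat `bsd-littype-01` (gen 2) of the cross-ladder literature-typing layer
(D-0088(4); cell `run/shared/lean/pub/bsd-littype/`). D-0064: one file for §11.3.1 of the source.
HONEST FRAMING: UNREFEREED preprint ⇒ an explicitly labelled OPEN hypothesis only (`def … : Prop`,
`[claim: …, status: under-review]`), NEVER a theorem, NEVER a `[cite:]`-fact; nothing asserted about
any curve; nothing booked; no `_holds`. ONE predicate WITH BODY (`CharIdealEqPadicLFunctionNeron W p`,
a definition: the cyclotomic statement "(MC)" for the pair `(E, p)` in the Néron normalisation —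
binder for binder the body of the Summits-side typed input (Mazur's (MC) for `(W, p)`, Néron normalisation) of
`Summits/…/Theorems/Rank1ResidualX1Defs.lean`, which a Literature file cannot import; the Summits
bridge is `Iff.rfl`; the predicate asserts nothing and its universal closure is NOT stated), ONE OPEN
binder, and bookkeeping theorems taking the binder as an explicit hypothesis.

WHY THIS STATEMENT (consumer): every printed road from a cyclotomic main conj. to the `p`-part of
BSD in analytic rank ONE at a good ordinary prime runs either through the `p`-adic Gross–Zagier
formula and Schneider's non-degeneracy of the cyclotomic `p`-adic height (ladder row I1, barrier
`Literature/Barriers/BirchSwinnertonDyer/PAdicHeightNondegeneracy.lean`) or through an anticyclotomic /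
BDP main conj. under big-image hypotheses ((sur), Jetchev–Skinner–Wan 2017; the Summits-side typed
input `IntegralMain…OnClassX9` (Theorems/Rank1ResidualX9Defs.lean) records "the rank-1 engine … has no tree vocabulary yet").
Prop. 11.11 is a HEIGHT-FREE road whose only Iwasawa-theoretic inputs are the two CYCLOTOMIC main
conj.s for `g` and `g ⊗ χ_L` (the cyclotomic Greenberg main conj. over `L` and its descent are derived
inside the paper from the two-variable zeta element, Prop. 9.18, and the `p`-adic Waldspurger formula):
so, granted this PRE binder, the rank-one residue at a good ordinary `p` with (van) reads "the
integral cyclotomic main conj. for `E` and for `E^{(d_L)}`" — the same currency as the rank-zero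
residue.

## The printed statement (arXiv:2409.01350v2, pp. 94–95; TeX label `p-BSD-prop`, tex l.7958)

> **Proposition 11.11.** Let `g ∈ S₂(Γ₀(N))` be an elliptic newform, `F` the Hecke field with degree
> `d` and `𝒪` the integer ring. Let `A_g` be an associated `GL₂`-type abelian variety over `ℚ` with
> `𝒪 ↪ End(A_g)`. Let `p ∤ 2N` be a prime, `λ` a prime of the Hecke field `F` above `p` and `T` the
> `λ`-adic Tate module of `A_g`. Suppose that • `ord_{s=1} L(s,g) = 1`, • Either `λ ∤ a_p(g)` or
> `a_p(g) = 0`, • The `λ`-adic Galois representation `ρ : G_ℚ → Aut_{𝒪_λ} T` satisfies (van_ℚ).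
> Let `L` be an imaginary quadratic field satisfying (ord), (coprime), (Heeg) and (van_L) so that
> `ord_{s=1} L(s, g/L) = 1`. Then the `λ`-adic Kato's main Conj[.] 9.6 for `g` and the quadratic
> twist `g' = g ⊗ χ_L` imply the `λ`-part of the Birch and Swinnerton-Dyer conj[.] for `A_g`, that
> is, `rank_ℤ A_g(ℚ) = d`, `Ш(A_g)[λ^∞]` is finite and
> `|L^{(d)}(1,A_g)/(d!·Ω_{A_g} R(A_g))|_λ^{-1} = |#Ш(A_g)[λ^∞] · ∏_{ℓ∣N} c_ℓ(A_g)|_λ^{-1}`.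

(ord) = (2.15) "`p` splits in `L`"; (coprime) = (9.9) "`(D_L, N) = 1`"; (Heeg) "`ℓ ∣ N ⟹ ℓ` splits
in `L`"; (van_M) "`T̄^{G_M} = 0`" (§2.2.2, tex l.1264–1270). Statement 9.6 (label `Kato`) is Kato's
main conj. in the strict-Selmer / zeta-quotient form; by Lemma 9.16 (i) (p. 82) it is EQUIVALENT, at
a prime `p ∤ N` of ordinary reduction, divisibility by divisibility, to statement 9.3 (label `KatopL`):
"`(𝓛_{α,ω,γ}(g)) = ξ(X(g))` in `Λ_{𝒪_λ} ⊗ ℚ_p` and even in `Λ_{𝒪_λ}` [integrally]" for `ω` good and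
`γ = γ_g` the OPTIMAL periods (§2.3, Lemma 2.5), which for an elliptic curve are "a `ℤ_(p)`-basis of
the lattice of Néron periods of `E_•`" for a curve `E_•` of the isogeny class (Rem. 2.3).

## Transcription (elliptic-curve instance `A_g = E`, `d = 1`, `λ = p`, ORDINARY branch `p ∤ a_p`)

`W` a globally minimal model of `E`, `N = W.conductorNorm ℤ`; `p ≠ 2`, good ordinary at `p`
(`p ∤ a_p`); `W.analyticRank = 1`; (van_ℚ) = `p ∤ #E(ℚ)_tors` (`E(ℚ)[p] = 0`); `L = K` imaginary
quadratic, `p` split, `(d_K, N) = 1`, Heegner hypothesis, `ord_{s=1} L(s, E/K) = 1` = `LDerivEK W K ≠ 0`;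
`E ⊗ χ_L` = a globally minimal model `W'` of the quadratic twist by `d_K` (`C • W' = W.quadraticTwist d_K`,
the twist entering `LDerivEK`); (van_L) = `E(K)[p] = 0` = (for odd `p`, by the `±`-decomposition under
`Gal(K/ℚ)`, `E[p](K)⁻ ≅ E^{(d_K)}[p](ℚ)`) `p ∤ #E(ℚ)_tors ∧ p ∤ #E^{(d_K)}(ℚ)_tors`. The two main-conj.
hypotheses = `CharIdealEqPadicLFunctionNeron W p` and `CharIdealEqPadicLFunctionNeron W' p` (the 9.3 (b)
form, INTEGRAL, Néron-normalised: for the cyclotomic `κ`, `γ` matching the cyclotomic variable, the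
newform `f` of level `N_E`, the rational `ϖ` with `ϖ·Ω_E = Ω⁺_f`, every dual datum `D` of
`Sel_{p^∞}(E/ℚ_∞)`: `D` torsion and `char_Λ D = (g)` with `ι g = ϖ·L_p(f, α)`, `α = unitRoot`).
READING FLAG `BSTW-1111-lattice`: the printed hypothesis is for the lattice `T = T_λ A_g` of an
`(𝒪,λ)`-optimally parametrised `A_g` and the optimal periods; we state it for the given globally
minimal `W` and ITS Néron period — literal for `W = E_•` (Rem. 2.3), and for any other curve of the
isogeny class equivalent to it by the isogeny invariance of the cyclotomic main conj. (Schneider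
1987 / Perrin-Riou; both sides change by the same power of `p`), a published theorem NOT restated here;
the conclusion is isogeny-invariant by Cassels. Conclusion = `rank_ℤ E(ℚ) = 1 ∧ Ш(E)[p^∞]` finite `∧`
the no-torsion print shape `L'(E,1)/(Ω_E·Reg E) = q ∈ ℚ`, `ord_p q = ord_p #Ш + ord_p ∏_ℓ c_ℓ`
(with `#Ш = W.shaOrder`; `p ∤ #E(ℚ)_tors` under (van_ℚ), so the torsion term of the general print shape
is a `p`-adic unit — `pPart_of_prop1111_OPEN`). The SUPERSINGULAR branch (`a_p = 0`: Kato's main conj.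
in the signed form, Lemma 9.16 (ii)) is NOT typed here — the signed main-conj. statement
(Kobayashi's signed statement, `Supersingular/KobayashiMain….lean`) lives Summits-side. -- TODO(general form): `a_p = 0`; `GL₂`-type `A_g`.

WEAKER-OR-EQUAL to print in every binder, modulo the reading flag above; never stronger. WHAT IS NOT
CLAIMED: nothing at `p = 2`, at `p ∣ N`, at supersingular `p`; no main conj. is asserted; no `_holds`.

## References
* [BurungaleSkinnerTianWan2024] arXiv:2409.01350v2: Prop. 11.11 (pp. 94–95; label p-BSD-prop, tex
  l.7958), Lemma 9.16 (p. 82; label KatoEq), statements 9.3 / 9.6 (pp. 80–81; labels KatopL / Kato),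
  Rem. 2.3 (label EC-optperiod-rmk), Lemma 2.5 (label GorPer), (2.15) = (ord), (9.9) = (coprime), (Heeg).
* [CastellaGrossiSkinner2025] Math. Ann. 393 (2025), Introduction (MC) and Thm. 2.1.1 — the Néron /
  Mazur–Swinnerton-Dyer normalised cyclotomic statement whose Lean spelling is reused
  (`thmA_charIdeal_eq_padicLFunction`'s conclusion; the Summits-side typed input of `Theorems/Rank1ResidualX1Defs.lean`).
* [Miller2011LMS] Def. 1.1 (`BSDp`); [Darmon2004] Thm. 3.22 (GZK, `rank_eq_analyticRank_of_analyticRank_le_one`).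
-/

noncomputable section

open scoped Classical MatrixGroups ModularForm

open CongruenceSubgroup WeierstrassCurve Literature.NumberTheory.EllipticCurves
  Literature.NumberTheory.EllipticCurves.ModularForms
  Literature.NumberTheory.EllipticCurves.Rank1Residual NumberField

namespace Literature.NumberTheory.EllipticCurves.BurungaleSkinnerTianWan2024

/-- **The cyclotomic statement (MC) for the pair `(E, p)`, Néron normalisation** — a PREDICATE on
`(W, p)` (definition with body; nothing asserted, no universal closure stated): for the cyclotomic
`ℤ_p`-extension `κ` with a topological generator `γ` matching the cyclotomic variable, the newform `f`
of `E` at level `N_E`, the rational `ϖ` with `ϖ · Ω_E = Ω⁺_f`, and every Pontryagin-dual datum `D` of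
`Sel_{p^∞}(E/ℚ_∞)`: `D` is `Λ`-torsion and `char_Λ D = (g)` with `ι g = ϖ · L_p(f, α)`
(`α = unitRoot W p`) — "`ch_{Λ_ℚ}(𝔛_ord(E/ℚ_∞)) = (𝓛_p^{MSD}(E/ℚ))`" (Castella–Grossi–Skinner 2025,
Introduction (MC), with Thm. 2.1.1 for `𝓛_p^{MSD}`; Mazur 1972). Binder for binder the body of the
Summits-side typed input (MC) of `Theorems/Rank1ResidualX1Defs.lean` (bridge `Iff.rfl`) and the
conclusion of the tree fact `CastellaGrossiSkinner2025.thmA_charIdeal_eq_padicLFunction`; it is BSTW's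
statement 9.3 (b) (label KatopL), integral form, for `g = f_E`, `γ = ` Néron periods (Rem. 2.3).
[cite: CastellaGrossiSkinner2025, Introduction (MC) and Thm. 2.1.1 (shape only; nothing asserted)]
[cite: BurungaleSkinnerTianWan2024, statement 9.3 (b) (p. 80; label KatopL) with Rem. 2.3 (shape only; nothing asserted)] -/
def CharIdealEqPadicLFunctionNeron (W : WeierstrassCurve ℚ) [W.IsElliptic] [W.IsGloballyMinimal]
    (p : ℕ) [Fact p.Prime] : Prop :=
  ∀ (κ : ZpExtension ℚ p) (γ : Field.absoluteGaloisGroup ℚ),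
      κ.IsCyclotomic → κ.IsTopGenerator γ → IsCyclotomicVariable p γ →
    ∀ [NeZero (W.conductorNorm ℤ)] (f : CuspForm (Gamma0 (W.conductorNorm ℤ)) 2),
      IsNewformOf W f → ∀ (ϖ : ℚ), (ϖ : ℝ) * W.realPeriodRat = plusPeriod f →
    ∀ (D : W.SelmerDualData κ γ), D.IsTorsion ∧
      ∃ g : IwasawaAlgebra p, D.charIdeal = Ideal.span {g} ∧
        iwasawaToPowerSeries p g =
          PowerSeries.C (ϖ : ℚ_[p]) * padicLFunction f (unitRoot W p : ℚ_[p])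

/-- Unfolding lemma for `CharIdealEqPadicLFunctionNeron` (definitional; the Summits-side
typed input (MC) of `Theorems/Rank1ResidualX1Defs.lean` has the same body). [cite: CastellaGrossiSkinner2025, Introduction (MC) (shape only)] -/
theorem charIdealEqPadicLFunctionNeron_iff (W : WeierstrassCurve ℚ) [W.IsElliptic]
    [W.IsGloballyMinimal] (p : ℕ) [Fact p.Prime] :
    CharIdealEqPadicLFunctionNeron W p ↔
      ∀ (κ : ZpExtension ℚ p) (γ : Field.absoluteGaloisGroup ℚ),
          κ.IsCyclotomic → κ.IsTopGenerator γ → IsCyclotomicVariable p γ →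
        ∀ [NeZero (W.conductorNorm ℤ)] (f : CuspForm (Gamma0 (W.conductorNorm ℤ)) 2),
          IsNewformOf W f → ∀ (ϖ : ℚ), (ϖ : ℝ) * W.realPeriodRat = plusPeriod f →
        ∀ (D : W.SelmerDualData κ γ), D.IsTorsion ∧
          ∃ g : IwasawaAlgebra p, D.charIdeal = Ideal.span {g} ∧
            iwasawaToPowerSeries p g =
              PowerSeries.C (ϖ : ℚ_[p]) * padicLFunction f (unitRoot W p : ℚ_[p]) :=
  Iff.rfl

/-- The tree's PUBLISHED Castella–Grossi–Skinner Theorem A supplies the predicate at a good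
NON-ANOMALOUS Eisenstein prime `p > 2` (`Red W p`, `¬ Anom W p`) — non-vacuity / example of a source.
[cite: CastellaGrossiSkinner2025, Theorem A (= Thm. 7.1.1)] -/
theorem charIdealEqPadicLFunctionNeron_of_thmA
    (hA : CastellaGrossiSkinner2025.thmA_charIdeal_eq_padicLFunction)
    (W : WeierstrassCurve ℚ) [W.IsElliptic] [W.IsGloballyMinimal] (p : ℕ) [Fact p.Prime]
    (hp : 2 < p) (hgood : Good W p) (hred : Red W p) (hna : ¬ Anom W p) :
    CharIdealEqPadicLFunctionNeron W p :=
  hA W p hp hgood hred hna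

/-- **OPEN HYPOTHESIS — UNREFEREED PREPRINT (arXiv:2409.01350v2), Prop. 11.11 (pp. 94–95), for an
elliptic curve, ORDINARY branch.** "Let `p ∤ 2N` … Suppose that `ord_{s=1} L(s,E) = 1`, `p ∤ a_p`,
and (van_ℚ). Let `L` be an imaginary quadratic field satisfying (ord), (coprime), (Heeg) and (van_L)
so that `ord_{s=1} L(s, E/L) = 1`. Then Kato's main conj[.] 9.6 for `g = f_E` and the quadratic twist
`g' = g ⊗ χ_L` imply the `p`-part of the BSD conj[.] for `E`, that is, `rank_ℤ E(ℚ) = 1`, `Ш(E)[p^∞]`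
is finite and `|L'(1,E)/(Ω_E R(E))|_p^{-1} = |#Ш(E)[p^∞]·∏_{ℓ∣N} c_ℓ(E)|_p^{-1}`." Transcribed (module
docstring): `W` globally minimal, `N = W.conductorNorm ℤ`; `p ≠ 2`, good at `p`, `p ∤ a_p`;
`W.analyticRank = 1`; `p ∤ #E(ℚ)_tors`; `K` imaginary quadratic, `p` split, `(d_K, N) = 1`, Heegner
hypothesis, `L'(E/K, 1) ≠ 0`; `W'` a globally minimal model of `E^{(d_K)}` (`C • W' = W.quadraticTwist d_K`)
with `p ∤ #E^{(d_K)}(ℚ)_tors` ((van_L), `p` odd); the two main-conj. hypotheses as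
`CharIdealEqPadicLFunctionNeron W p` and `… W' p` (statement 9.3 (b) ≡ 9.6 (b) at an ordinary `p ∤ N`,
Lemma 9.16 (i); READING FLAG `BSTW-1111-lattice` in the module docstring); conclusion
`rank = 1 ∧ Ш[p^∞]` finite `∧` the no-torsion print shape at `p`. NEVER cite this `Prop` as a theorem;
take it as an explicit hypothesis. [claim: BurungaleSkinnerTianWan2024, status: under-review]
[cite: BurungaleSkinnerTianWan2024, Prop. 11.11 (pp. 94–95; label p-BSD-prop, tex l.7958) with Lemma 9.16 (i) (p. 82) (ANNOUNCED, OPEN binder)] -/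
def prop1111_pPart_rankOne_of_mainStatements_ordinary_OPEN : Prop :=
  ∀ (W W' : WeierstrassCurve ℚ) [W.IsElliptic] [W.IsGloballyMinimal] [NeZero (W.conductorNorm ℤ)]
    [W'.IsElliptic] [W'.IsGloballyMinimal] (p : ℕ) [Fact p.Prime]
    (K : Type) [Field K] [NumberField K] (C : VariableChange ℚ),
    -- `p ∤ 2N` ordinary, analytic rank one, (van_ℚ)
    p ≠ 2 → W.HasGoodReductionAtPrime p → ¬ (p : ℤ) ∣ W.frobeniusTrace p →
    W.analyticRank = 1 → ¬ p ∣ W.torsionOrder →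
    -- `L = K`: imaginary quadratic, (ord), (coprime), (Heeg), `ord_{s=1} L(s, E/K) = 1`
    IsImaginaryQuadratic K →
    ((Ideal.span {(p : ℤ)}).primesOver (𝓞 K)).ncard = 2 →
    IsCoprime (NumberField.discr K) (W.conductorNorm ℤ) →
    SatisfiesHeegnerHypothesis (W.conductorNorm ℤ) K →
    LDerivEK W K ≠ 0 →
    -- `E ⊗ χ_L` = the twist by `d_K`, model `W'`; (van_L)
    C • W' = W.quadraticTwist (NumberField.discr K : ℚ) → ¬ p ∣ W'.torsionOrder →
    -- Kato's main conj. (9.3 (b) form, integral, Néron normalisation) for `E` and for `E ⊗ χ_L`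
    CharIdealEqPadicLFunctionNeron W p → CharIdealEqPadicLFunctionNeron W' p →
    -- the `p`-part of BSD for `E` in rank one
    W.mordellWeilRank = 1 ∧ Finite (AddCommGroup.primaryComponent W.sha p) ∧
      ∃ q : ℚ, W.leadingLCoeff / ((W.realPeriodRat * W.regulator : ℝ) : ℂ) = (q : ℂ) ∧
        padicValRat p q = (padicValNat p W.shaOrder : ℤ) + padicValNat p W.tamagawaProduct

variable (W W' : WeierstrassCurve ℚ) [W.IsElliptic] [W.IsGloballyMinimal] [NeZero (W.conductorNorm ℤ)]
  [W'.IsElliptic] [W'.IsGloballyMinimal] (p : ℕ) [Fact p.Prime]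
  {K : Type} [Field K] [NumberField K] {C : VariableChange ℚ}

/-- **Granted the OPEN binder, the two cyclotomic main-conj. statements give the general print shape
`PPart W p` in rank one** (the torsion term `2·ord_p #E(ℚ)_tors` vanishes under (van_ℚ):
`padicValNat.eq_zero_of_not_dvd`). CONDITIONAL; closes nothing.
[claim: BurungaleSkinnerTianWan2024, status: under-review]
[cite: BurungaleSkinnerTianWan2024, Prop. 11.11 (pp. 94–95; OPEN binder)] [cite: YanZhu2026, Thm. 4.15 (display; shape of `PPart`)] -/
theorem pPart_of_prop1111_OPEN (hBSTW_OPEN : prop1111_pPart_rankOne_of_mainStatements_ordinary_OPEN)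
    (hp2 : p ≠ 2) (hgood : W.HasGoodReductionAtPrime p) (hord : ¬ (p : ℤ) ∣ W.frobeniusTrace p)
    (hr : W.analyticRank = 1) (hvan : ¬ p ∣ W.torsionOrder) (hK : IsImaginaryQuadratic K)
    (hsplit : ((Ideal.span {(p : ℤ)}).primesOver (𝓞 K)).ncard = 2)
    (hcop : IsCoprime (NumberField.discr K) (W.conductorNorm ℤ))
    (hH : SatisfiesHeegnerHypothesis (W.conductorNorm ℤ) K) (hL : LDerivEK W K ≠ 0)
    (hC : C • W' = W.quadraticTwist (NumberField.discr K : ℚ)) (hvan' : ¬ p ∣ W'.torsionOrder)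
    (hMC : CharIdealEqPadicLFunctionNeron W p) (hMC' : CharIdealEqPadicLFunctionNeron W' p) :
    W.mordellWeilRank = 1 ∧ Finite (AddCommGroup.primaryComponent W.sha p) ∧ PPart W p := by
  obtain ⟨hrank, hfin, q, hq, hv⟩ :=
    hBSTW_OPEN W W' p K C hp2 hgood hord hr hvan hK hsplit hcop hH hL hC hvan' hMC hMC'
  refine ⟨hrank, hfin, q, hq, ?_⟩
  rw [hv, padicValNat.eq_zero_of_not_dvd hvan]
  push_cast
  ring

/-- **Granted the OPEN binder: Miller's `BSD(E,p)` in analytic rank one from the two cyclotomic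
main-conj. statements** — via the tree bridge `bsdp_of_pPart` (modularity `hmod` for `L'(E,1) ≠ 0`,
Gross–Zagier–Kolyvagin `hGZK` for `rank = r_an` and finiteness of `Ш`, both PUBLISHED named facts by
name). This is the HEIGHT-FREE rank-one road of the source: no Schneider non-degeneracy, no (sur),
no semistability. CONDITIONAL on the PRE binder; closes nothing; no class is booked.
[claim: BurungaleSkinnerTianWan2024, status: under-review]
[cite: BurungaleSkinnerTianWan2024, Prop. 11.11 (pp. 94–95; OPEN binder)] [cite: Miller2011LMS, §1 and Def. 1.1] -/
theorem bsdp_of_prop1111_OPEN (hBSTW_OPEN : prop1111_pPart_rankOne_of_mainStatements_ordinary_OPEN)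
    (hmod : hasEntireLFunction_rat) (hGZK : rank_eq_analyticRank_of_analyticRank_le_one)
    (hp2 : p ≠ 2) (hgood : W.HasGoodReductionAtPrime p) (hord : ¬ (p : ℤ) ∣ W.frobeniusTrace p)
    (hr : W.analyticRank = 1) (hvan : ¬ p ∣ W.torsionOrder) (hK : IsImaginaryQuadratic K)
    (hsplit : ((Ideal.span {(p : ℤ)}).primesOver (𝓞 K)).ncard = 2)
    (hcop : IsCoprime (NumberField.discr K) (W.conductorNorm ℤ))
    (hH : SatisfiesHeegnerHypothesis (W.conductorNorm ℤ) K) (hL : LDerivEK W K ≠ 0)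
    (hC : C • W' = W.quadraticTwist (NumberField.discr K : ℚ)) (hvan' : ¬ p ∣ W'.torsionOrder)
    (hMC : CharIdealEqPadicLFunctionNeron W p) (hMC' : CharIdealEqPadicLFunctionNeron W' p) :
    BSDp W p :=
  bsdp_of_pPart W p hmod hGZK hr.le
    (pPart_of_prop1111_OPEN W W' p hBSTW_OPEN hp2 hgood hord hr hvan hK hsplit hcop hH hL hC hvan'
      hMC hMC').2.2

end Literature.NumberTheory.EllipticCurves.BurungaleSkinnerTianWan2024

end
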